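import Mathlib
import Literature.NumberTheory.LFunctions.Zhang2022.Section15BEq1515Poles
import HarnessLib

/-!
# Zhang (2022) §15 (15.15): the contour shift for the §15.u036 integrand — residue theorem applied
# (four simple poles `−β₁, −β₂, −β₃, ρ̃−1`), pointwise core with explicit hypotheses

Topic `Literature/NumberTheory/LFunctions/Zhang2022` (Landau–Siegel audit tree; verdict-neutral).
Y. Zhang, *Discrete mean estimates and the Landau–Siegel zero*, arXiv:2211.02515v1 (2022)
[Zhang2022LandauSiegel] — **an unrefereed manuscript under adjudication**; nothing here is a claim of
the manuscript. Display (15.15) [Z22 p.85, tex L4218–4224]: "In a way similar to the proof of Lemma 8.4,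
we deduce that `𝒟₁(d,l) = λ₁(d)Σ_{j≤3}ℛ_{1j}d^{β_j}ℳ₁(d,l;1−β_j) + O(ε₁)` … (15.16) also has a simple
pole at `s = ρ̃ − 1`, while the residue at this point can be regarded as an acceptable error." This
file applies the tree's Landau-rectangle engine for the Gaussian Perron kernel
(`GaussKernelContour.norm_lineIntegral_sub_residues_le_of_simplePoles`, p473527) to the integrand
`G = Φ·K` of §15.u036 with the pole data of `Section15BEq1515Poles`: for ABSTRACT `M` (= `ℳ₁(d,l;·)`),
`c`, purely imaginary distinct non-zero `β_a, β_b, β` and a real simple zero `ρ < 1` of `L(s,χ)`, and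
under explicit zero-free / size hypotheses on the rectangle `[a,1] × [−H,H]`,
`‖(1/2π)∫_ℝ Φ(1+it)K(1+it)dt − (R_a + R_b + R_β + R_ρ)‖ ≤ E(M₀,M₁,M₂)` (`core`), where `R_a, R_b, R_β`
are the residues at `−β_a, −β_b, −β` in closed form (`resA_eq`, `resBeta_eq`) and `R_ρ` the residue at
`ρ − 1`, with the size bound `norm_resRho_le` (`≍ (1−ρ)·|β|⁻³` — polynomially small under (A), NOT
`O(ε₁)`: the reading of record of the "acceptable error", cf. the lane advisory of the engine's author).
The arithmetic (which `ρ`, the zero-free regions, `ℳ₁`'s size, the identification `R_j =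
ℛ_{1j}d^{β_j}ℳ₁(d,l;1−β_j)`) is supplied by `Section15BEq1515Ranged`.
[cite: Zhang2022LandauSiegel, §15 (15.15)–(15.16) p.85]

## References
* Y. Zhang, arXiv:2211.02515v1 (2022), §15 (15.15)–(15.16) p.85. [cite: Zhang2022LandauSiegel, §15 (15.15)]
* H. L. Montgomery, R. C. Vaughan, *Multiplicative Number Theory I*, CUP 2007, §6.2. [cite: MontgomeryVaughan2007, §6.2]
-/

noncomputable section

open Complex Real Set Filter Topology MeasureTheory
open scoped Interval

namespace Literature.NumberTheory.LFunctions.Zhang2022.Eq1515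

open Literature.NumberTheory.LFunctions.Zhang2022.GaussWeight

variable {D : ℕ} [NeZero D] (χ : DirichletCharacter ℂ D)
variable (Φ M : ℂ → ℂ) (cst βa βb β : ℂ) (Y Λ : ℝ)

/-! ### The four residues as explicit numbers -/

/-- The residue numerator at `−β_a` evaluated: `φ_a(−β_a) =
ζ₁(1)·ζ(1−β_a+β_b)·(M(1−β_a)c(−β_a)/(ζ₁(1−β_a)L(1−β_a,χ)))·Y^{β−β_a}ω₁(β−β_a)/(β−β_a)`, and
`ζ₁(1) = 1`, `(−β_a)/ζ₁(1−β_a) = 1/ζ(1−β_a)` (`β_a ≠ 0`): the residue of `G` at `−β_a` is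
`ζ(1−β_a+β_b)ζ(1−β_a)⁻¹L(1−β_a,χ)⁻¹·M(1−β_a)c·Y^{β−β_a}ω₁(β−β_a)/(β−β_a)` (in (15.15):
`ℛ_{1j}d^{β_j}ℳ₁(d,l;1−β_j)`, `j = 1, 2`). [cite: Zhang2022LandauSiegel, §15 (15.16) p.85] -/
theorem resA_eq (ha0 : βa ≠ 0) (hζ : riemannZeta (1 - βa) ≠ 0) (hL : χ.LFunction (1 - βa) ≠ 0) :
    riemannZeta₁ (1 + -βa + βa) * riemannZeta (1 + -βa + βb) *
        (M (1 + -βa) * cst * -βa / (riemannZeta₁ (1 + -βa) * χ.LFunction (1 + -βa))) *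
        ((Y : ℂ) ^ (-βa + β) * omega1 Λ (-βa + β)) / (-βa + β) =
      riemannZeta (1 - βa + βb) / (riemannZeta (1 - βa) * χ.LFunction (1 - βa)) *
        (M (1 - βa) * cst) * ((Y : ℂ) ^ (β - βa) * omega1 Λ (β - βa) / (β - βa)) := by
  have h1 : (1 : ℂ) + -βa ≠ 1 := by intro h; apply ha0; linear_combination -h
  have hβ' : (-βa : ℂ) ≠ 0 := neg_ne_zero.mpr ha0
  have hz1 : riemannZeta₁ (1 + -βa) = -βa * riemannZeta (1 + -βa) := by
    have h := riemannZeta_eq_inv_sub_mul h1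
    rw [show (1 : ℂ) + -βa - 1 = -βa by ring] at h
    rw [h, ← mul_assoc, mul_inv_cancel₀ hβ', one_mul]
  rw [show (1 : ℂ) + -βa + βa = 1 by ring, riemannZeta₁_one, one_mul, hz1,
    show (1 : ℂ) + -βa + βb = 1 - βa + βb by ring, show (1 : ℂ) + -βa = 1 - βa by ring,
    show (-βa : ℂ) + β = β - βa by ring]
  field_simp

/-- The residue numerator at `−β` (the kernel's pole) evaluated: `Φ(−β)·Y⁰ω₁(0) = Φ(−β)`, and
`(−β)/ζ₁(1−β) = 1/ζ(1−β)` (`β ≠ 0`): the residue of `G` at `−β` is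
`ζ(1−β+β_a)ζ(1−β+β_b)ζ(1−β)⁻¹L(1−β,χ)⁻¹·M(1−β)c` (in (15.15): `ℛ₁₃d^{β₃}ℳ₁(d,l;1−β₃)`).
[cite: Zhang2022LandauSiegel, §15 (15.16) p.85] -/
theorem resBeta_eq (hβ0 : β ≠ 0)
    (hΦ : ∀ s, Φ s = riemannZeta (1 + s + βa) * riemannZeta (1 + s + βb) * M (1 + s) * cst * s /
      (riemannZeta₁ (1 + s) * χ.LFunction (1 + s))) :
    Φ (-β) * ((Y : ℂ) ^ (-β + β) * omega1 Λ (-β + β)) =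
      riemannZeta (1 - β + βa) * riemannZeta (1 - β + βb) /
        (riemannZeta (1 - β) * χ.LFunction (1 - β)) * (M (1 - β) * cst) := by
  rw [GaussKernelContour.kernel_num_at_neg, mul_one, Phi_eq_of_ne_zero χ Φ M cst βa βb hΦ
    (neg_ne_zero.mpr hβ0)]
  rw [show (1 : ℂ) + -β + βa = 1 - β + βa by ring, show (1 : ℂ) + -β + βb = 1 - β + βb by ring,
    show (1 : ℂ) + -β = 1 - β by ring]
  ring

/-- **Size of the residue at the exceptional zero** `s = ρ − 1` ((15.15): "the residue at this point
can be regarded as an acceptable error"). With `ψ(ρ) = L′(ρ,χ)` (`dslope`), the residue is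
`ζ(ρ+β_a)ζ(ρ+β_b)·M(ρ)c(ρ−1)/(ζ₁(ρ)L′(ρ,χ))·Y^{ρ−1+β}ω₁(ρ−1+β)/(ρ−1+β)`; if `‖ζ(ρ+β_a)‖ ≤ Z_a`,
`‖ζ(ρ+β_b)‖ ≤ Z_b`, `‖M(ρ)‖ ≤ M_M`, `‖c‖ ≤ 1`, `‖ζ₁(ρ)‖ ≥ 1/2`, `‖L′(ρ,χ)‖ ≥ L_min > 0`, `Y ≥ 1`,
`ρ ≤ 1`, `(1−ρ)² ≤ 4Λ` and `‖ρ−1+β‖ ≥ b_min > 0` (`Re β = 0`), then it is at most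
`Z_a·Z_b·M_M·(1−ρ)·(2/L_min)·(e/b_min)` — the only small factor is `1 − ρ` (`= (ρ−1)`, from
`1/ζ(ρ) = (ρ−1)/ζ₁(ρ)`). [cite: Zhang2022LandauSiegel, §15 (15.15) p.85] -/
theorem norm_resRho_le {ρ Za Zb MM Lmin bmin : ℝ} (hΛ : 0 < Λ) (hY : 1 ≤ Y) (hρ1 : ρ ≤ 1)
    (hβ : β.re = 0) (hZa : ‖riemannZeta (ρ + βa)‖ ≤ Za) (hZb : ‖riemannZeta (ρ + βb)‖ ≤ Zb)
    (hMM : ‖M ρ‖ ≤ MM) (hcst : ‖cst‖ ≤ 1) (hζ1 : 1 / 2 ≤ ‖riemannZeta₁ ρ‖) (hLmin : 0 < Lmin)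
    (hL' : Lmin ≤ ‖deriv χ.LFunction ρ‖) (hbmin : 0 < bmin) (hb : bmin ≤ ‖((ρ - 1 : ℝ) : ℂ) + β‖)
    (hρΛ : (1 - ρ) ^ 2 ≤ 4 * Λ) :
    ‖riemannZeta (1 + ((ρ - 1 : ℝ) : ℂ) + βa) * riemannZeta (1 + ((ρ - 1 : ℝ) : ℂ) + βb) *
        (M (1 + ((ρ - 1 : ℝ) : ℂ)) * cst * ((ρ - 1 : ℝ) : ℂ) /
          (riemannZeta₁ (1 + ((ρ - 1 : ℝ) : ℂ)) * dslope (fun w => χ.LFunction w) ρ (1 + ((ρ - 1 : ℝ) : ℂ)))) *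
        ((Y : ℂ) ^ (((ρ - 1 : ℝ) : ℂ) + β) * omega1 Λ (((ρ - 1 : ℝ) : ℂ) + β) /
          (((ρ - 1 : ℝ) : ℂ) + β))‖ ≤
      Za * Zb * MM * (1 - ρ) * (2 / Lmin) * (Real.exp 1 / bmin) := by
  have h1ρ : (1 : ℂ) + ((ρ - 1 : ℝ) : ℂ) = (ρ : ℂ) := by push_cast; ring
  rw [show (1 : ℂ) + ((ρ - 1 : ℝ) : ℂ) + βa = ρ + βa by rw [h1ρ],
    show (1 : ℂ) + ((ρ - 1 : ℝ) : ℂ) + βb = ρ + βb by rw [h1ρ], h1ρ, dslope_same]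
  -- nonnegativity of the bound parameters
  have hZa0 : 0 ≤ Za := (norm_nonneg _).trans hZa
  have hZb0 : 0 ≤ Zb := (norm_nonneg _).trans hZb
  have hMM0 : 0 ≤ MM := (norm_nonneg _).trans hMM
  have hρ0 : 0 ≤ 1 - ρ := by linarith
  -- the pieces
  have hnum : ‖M ρ * cst * ((ρ - 1 : ℝ) : ℂ)‖ ≤ MM * (1 - ρ) := by
    rw [norm_mul, norm_mul, Complex.norm_real, Real.norm_eq_abs, abs_of_nonpos (by linarith),
      neg_sub]
    calc ‖M ρ‖ * ‖cst‖ * (1 - ρ) ≤ MM * 1 * (1 - ρ) := by gcongr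
      _ = MM * (1 - ρ) := by ring
  have hden : Lmin * (1 / 2) ≤ ‖riemannZeta₁ ρ * deriv χ.LFunction ρ‖ := by
    rw [norm_mul]
    calc Lmin * (1 / 2) = (1 / 2) * Lmin := by ring
      _ ≤ ‖riemannZeta₁ ↑ρ‖ * ‖deriv χ.LFunction ↑ρ‖ :=
          mul_le_mul hζ1 hL' hLmin.le (norm_nonneg _)
  have hden0 : 0 < Lmin * (1 / 2) := by positivity
  have hfrac : ‖M ρ * cst * ((ρ - 1 : ℝ) : ℂ) /
      (riemannZeta₁ ρ * deriv χ.LFunction ρ)‖ ≤ MM * (1 - ρ) * (2 / Lmin) := by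
    rw [norm_div]
    calc ‖M ρ * cst * ((ρ - 1 : ℝ) : ℂ)‖ / ‖riemannZeta₁ ρ * deriv χ.LFunction ρ‖
        ≤ (MM * (1 - ρ)) / (Lmin * (1 / 2)) := div_le_div₀ (by positivity) hnum hden0 hden
      _ = MM * (1 - ρ) * (2 / Lmin) := by field_simp
  -- the kernel at `ρ − 1`
  have hY0 : 0 < Y := by linarith
  have hK : ‖(Y : ℂ) ^ (((ρ - 1 : ℝ) : ℂ) + β) * omega1 Λ (((ρ - 1 : ℝ) : ℂ) + β) /
      (((ρ - 1 : ℝ) : ℂ) + β)‖ ≤ Real.exp 1 / bmin := by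
    rw [norm_div, norm_mul]
    have hYpow : ‖(Y : ℂ) ^ (((ρ - 1 : ℝ) : ℂ) + β)‖ ≤ 1 := by
      rw [Complex.norm_cpow_eq_rpow_re_of_pos hY0]
      have hre : ((((ρ - 1 : ℝ) : ℂ) + β).re) = ρ - 1 := by simp [hβ]
      rw [hre]
      exact Real.rpow_le_one_of_one_le_of_nonpos hY (by linarith)
    have hω : ‖omega1 Λ (((ρ - 1 : ℝ) : ℂ) + β)‖ ≤ Real.exp 1 := by
      have heq : ((ρ - 1 : ℝ) : ℂ) + β = ((ρ - 1 : ℝ) : ℂ) + (β.im : ℂ) * I := by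
        conv_lhs => rw [← Complex.re_add_im β]
        simp [hβ]
      rw [heq, norm_omega1]
      refine Real.exp_le_exp.mpr ?_
      rw [div_le_one (by positivity)]
      nlinarith [sq_nonneg β.im]
    calc ‖(Y : ℂ) ^ (((ρ - 1 : ℝ) : ℂ) + β)‖ * ‖omega1 Λ (((ρ - 1 : ℝ) : ℂ) + β)‖ /
          ‖((ρ - 1 : ℝ) : ℂ) + β‖ ≤ (1 * Real.exp 1) / bmin := by
          refine div_le_div₀ (by positivity) ?_ hbmin hb
          exact mul_le_mul hYpow hω (norm_nonneg _) zero_le_one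
      _ = Real.exp 1 / bmin := by ring
  -- assemble
  rw [norm_mul, norm_mul, norm_mul]
  have e1 : ‖riemannZeta (↑ρ + βa)‖ * ‖riemannZeta (↑ρ + βb)‖ ≤ Za * Zb :=
    mul_le_mul hZa hZb (norm_nonneg _) hZa0
  calc ‖riemannZeta (↑ρ + βa)‖ * ‖riemannZeta (↑ρ + βb)‖ *
        ‖M ↑ρ * cst * ((ρ - 1 : ℝ) : ℂ) / (riemannZeta₁ ↑ρ * deriv χ.LFunction ↑ρ)‖ *
        ‖(Y : ℂ) ^ (((ρ - 1 : ℝ) : ℂ) + β) * omega1 Λ (((ρ - 1 : ℝ) : ℂ) + β) / (((ρ - 1 : ℝ) : ℂ) + β)‖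
      ≤ (Za * Zb) * (MM * (1 - ρ) * (2 / Lmin)) * (Real.exp 1 / bmin) := by
        refine mul_le_mul (mul_le_mul e1 hfrac (norm_nonneg _) (by positivity)) hK (norm_nonneg _)
          (by positivity)
    _ = Za * Zb * MM * (1 - ρ) * (2 / Lmin) * (Real.exp 1 / bmin) := by ring

/-! ### The contour shift with the four residues -/

/-- **The residue theorem applied to the §15.u036 integrand on Landau's rectangle** (pointwise core,
all arithmetic inputs explicit). Let `Φ` be the regularised first factor (`hΦ`), `K` the Gaussian
Perron kernel with `Y, Λ > 0`, `β_a, β_b, β` purely imaginary, non-zero, pairwise distinct, with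
imaginary parts `< H` in size; let `ρ < 1` be a real simple zero of `L(s,χ)` with `a < ρ − 1`; suppose
`ζ₁(1+z) ≠ 0` and (`z ≠ ρ−1` ⇒ `L(1+z,χ) ≠ 0`) on the open box `a₁ < Re z < 2`, `|Im z| < H₁`
(`−1/10 ≤ a₁ < a < 0`, `H < H₁`), and the sizes `‖Φ‖ ≤ M₀` on the tails of `Re s = 1`, `≤ M₁` on
`Re s = a, |t| ≤ H`, `≤ M₂` on `Im s = ±H`, with `Φ·K` integrable along `Re s = 1`. Then
`(1/2π)∫_ℝ Φ(1+it)K(1+it)dt` differs from the sum of the four residues (at `−β_a, −β_b, −β, ρ−1`, each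
given by its explicit numerator from `Section15BEq1515Poles`) by at most the engine's
`(1/2π)(E_tails + E_left + 2E_horiz)`. [cite: Zhang2022LandauSiegel, §15 (15.15)–(15.16) p.85]
[cite: MontgomeryVaughan2007, §6.2] -/
theorem core (hχ1 : χ ≠ 1) (hMd : DifferentiableOn ℂ M {w : ℂ | 9 / 10 < w.re})
    (hY : 0 < Y) (hΛ : 0 < Λ)
    (hΦ : ∀ s, Φ s = riemannZeta (1 + s + βa) * riemannZeta (1 + s + βb) * M (1 + s) * cst * s /
      (riemannZeta₁ (1 + s) * χ.LFunction (1 + s)))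
    (hβa : βa.re = 0) (hβb : βb.re = 0) (hβ : β.re = 0)
    (ha0 : βa ≠ 0) (hb0 : βb ≠ 0) (hβ0 : β ≠ 0) (hab : βa ≠ βb) (haβ : βa ≠ β) (hbβ : βb ≠ β)
    {a a₁ H H₁ : ℝ} (ha₁ : -(1 / 10 : ℝ) ≤ a₁) (ha₁a : a₁ < a) (ha : a < 0) (hHH₁ : H < H₁)
    (hβH : |β.im| < H) (hβaH : |βa.im| < H) (hβbH : |βb.im| < H)
    {ρ : ℝ} (hρL : χ.LFunction ρ = 0) (hρL' : deriv χ.LFunction ρ ≠ 0) (hρ1 : ρ < 1)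
    (haρ : a < ρ - 1)
    (hUζ : ∀ z : ℂ, a₁ < z.re → z.re < 2 → |z.im| < H₁ → riemannZeta₁ (1 + z) ≠ 0)
    (hUL : ∀ z : ℂ, a₁ < z.re → z.re < 2 → |z.im| < H₁ → z ≠ ((ρ - 1 : ℝ) : ℂ) →
      χ.LFunction (1 + z) ≠ 0)
    {M₀ M₁ M₂ : ℝ} (hM₀ : 0 ≤ M₀) (hM₁ : 0 ≤ M₁) (hM₂ : 0 ≤ M₂)
    (hΦ₀ : ∀ t : ℝ, H ≤ |t| → ‖Φ (((1 : ℝ) : ℂ) + t * I)‖ ≤ M₀)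
    (hΦ₁ : ∀ t : ℝ, |t| ≤ H → ‖Φ ((a : ℂ) + t * I)‖ ≤ M₁)
    (hΦ₂ : ∀ u : ℝ, a ≤ u → u ≤ 1 →
      ‖Φ ((u : ℂ) + (H : ℂ) * I)‖ ≤ M₂ ∧ ‖Φ ((u : ℂ) + ((-H : ℝ) : ℂ) * I)‖ ≤ M₂)
    (hint : Integrable fun t : ℝ => Φ (((1 : ℝ) : ℂ) + t * I) *
      ((Y : ℂ) ^ (((1 : ℝ) : ℂ) + t * I + β) * omega1 Λ (((1 : ℝ) : ℂ) + t * I + β) /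
        (((1 : ℝ) : ℂ) + t * I + β))) :
    ‖(1 / (2 * π) : ℂ) * (∫ t : ℝ, Φ (((1 : ℝ) : ℂ) + t * I) *
        ((Y : ℂ) ^ (((1 : ℝ) : ℂ) + t * I + β) * omega1 Λ (((1 : ℝ) : ℂ) + t * I + β) /
          (((1 : ℝ) : ℂ) + t * I + β))) -
      ( -- residue at `−β_a`
        riemannZeta₁ (1 + -βa + βa) * riemannZeta (1 + -βa + βb) *
          (M (1 + -βa) * cst * -βa / (riemannZeta₁ (1 + -βa) * χ.LFunction (1 + -βa))) *
          ((Y : ℂ) ^ (-βa + β) * omega1 Λ (-βa + β)) / (-βa + β) +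
        -- residue at `−β_b`
        riemannZeta₁ (1 + -βb + βb) * riemannZeta (1 + -βb + βa) *
          (M (1 + -βb) * cst * -βb / (riemannZeta₁ (1 + -βb) * χ.LFunction (1 + -βb))) *
          ((Y : ℂ) ^ (-βb + β) * omega1 Λ (-βb + β)) / (-βb + β) +
        -- residue at `−β`
        Φ (-β) * ((Y : ℂ) ^ (-β + β) * omega1 Λ (-β + β)) +
        -- residue at `ρ − 1`
        riemannZeta (1 + ((ρ - 1 : ℝ) : ℂ) + βa) * riemannZeta (1 + ((ρ - 1 : ℝ) : ℂ) + βb) *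
          (M (1 + ((ρ - 1 : ℝ) : ℂ)) * cst * ((ρ - 1 : ℝ) : ℂ) /
            (riemannZeta₁ (1 + ((ρ - 1 : ℝ) : ℂ)) *
              dslope (fun w => χ.LFunction w) ρ (1 + ((ρ - 1 : ℝ) : ℂ)))) *
          ((Y : ℂ) ^ (((ρ - 1 : ℝ) : ℂ) + β) * omega1 Λ (((ρ - 1 : ℝ) : ℂ) + β) /
            (((ρ - 1 : ℝ) : ℂ) + β)))‖ ≤
      1 / (2 * π) *
        (2 * (M₀ * (Y ^ ((1 : ℝ) + β.re) * rexp (((1 : ℝ) + β.re) ^ 2 / (4 * Λ)) / |(1 : ℝ) + β.re|) *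
            (gauss (4 * Λ)⁻¹ (H - |β.im|) * (Real.sqrt (4 * π * Λ) / 2))) +
          M₁ * (Y ^ (a + β.re) * rexp ((a + β.re) ^ 2 / (4 * Λ)) / |a + β.re|) *
            Real.sqrt (4 * π * Λ) +
          2 * (((1 : ℝ) - a) * (M₂ * (max (Y ^ (a + β.re)) (Y ^ ((1 : ℝ) + β.re)) *
            rexp (max ((a + β.re) ^ 2) (((1 : ℝ) + β.re) ^ 2) / (4 * Λ)) *
            gauss (4 * Λ)⁻¹ (H - |β.im|) / (H - |β.im|))))) := by
  classical
  -- the four poles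
  set pa : ℂ := -βa with hpa
  set pb : ℂ := -βb with hpb
  set pk : ℂ := -β with hpk
  set pr : ℂ := ((ρ - 1 : ℝ) : ℂ) with hpr
  -- their numerators
  set φa : ℂ → ℂ := fun z => riemannZeta₁ (1 + z + βa) * riemannZeta (1 + z + βb) *
      (M (1 + z) * cst * z / (riemannZeta₁ (1 + z) * χ.LFunction (1 + z))) *
      ((Y : ℂ) ^ (z + β) * omega1 Λ (z + β)) / (z + β) with hφa
  set φb : ℂ → ℂ := fun z => riemannZeta₁ (1 + z + βb) * riemannZeta (1 + z + βa) *
      (M (1 + z) * cst * z / (riemannZeta₁ (1 + z) * χ.LFunction (1 + z))) *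
      ((Y : ℂ) ^ (z + β) * omega1 Λ (z + β)) / (z + β) with hφb
  set φk : ℂ → ℂ := fun z => Φ z * ((Y : ℂ) ^ (z + β) * omega1 Λ (z + β)) with hφk
  set φr : ℂ → ℂ := fun z => riemannZeta (1 + z + βa) * riemannZeta (1 + z + βb) *
      (M (1 + z) * cst * z / (riemannZeta₁ (1 + z) * dslope (fun w => χ.LFunction w) ρ (1 + z))) *
      ((Y : ℂ) ^ (z + β) * omega1 Λ (z + β) / (z + β)) with hφr
  -- distinctness
  have hβaim : βa.im ≠ 0 := fun h => ha0 (Complex.ext (by simpa using hβa) (by simpa using h))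
  have hβbim : βb.im ≠ 0 := fun h => hb0 (Complex.ext (by simpa using hβb) (by simpa using h))
  have hβim : β.im ≠ 0 := fun h => hβ0 (Complex.ext (by simpa using hβ) (by simpa using h))
  have hab' : pa ≠ pb := fun h => hab (neg_injective h)
  have hak' : pa ≠ pk := fun h => haβ (neg_injective h)
  have hbk' : pb ≠ pk := fun h => hbβ (neg_injective h)
  have har' : pa ≠ pr := by
    intro h; apply hβaim
    have := congrArg Complex.im h
    simpa [hpa, hpr] using this
  have hbr' : pb ≠ pr := by
    intro h; apply hβbim
    have := congrArg Complex.im h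
    simpa [hpb, hpr] using this
  have hkr' : pk ≠ pr := by
    intro h; apply hβim
    have := congrArg Complex.im h
    simpa [hpk, hpr] using this
  -- the pole set and the numerator family
  set S : Finset ℂ := {pa, pb, pk, pr} with hS
  set φ : ℂ → ℂ → ℂ := fun p => if p = pa then φa else if p = pb then φb else if p = pk then φk else φr
    with hφ
  have hφpa : φ pa = φa := by simp [hφ]
  have hφpb : φ pb = φb := by simp [hφ, hab'.symm]
  have hφpk : φ pk = φk := by simp [hφ, hak'.symm, hbk'.symm]
  have hφpr : φ pr = φr := by simp [hφ, har'.symm, hbr'.symm, hkr'.symm]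
  -- the open neighbourhood of the closed rectangle
  set U : Set ℂ := (Ioo a₁ 2) ×ℂ (Ioo (-H₁) H₁) with hU
  have hUopen : IsOpen U := isOpen_Ioo.reProdIm isOpen_Ioo
  have hH : 0 < H := lt_of_le_of_lt (abs_nonneg _) hβH
  have hKU : Icc a 1 ×ℂ Icc (-H) H ⊆ U := by
    intro z hz
    obtain ⟨⟨h1, h2⟩, h3, h4⟩ := hz
    exact ⟨⟨by linarith, by linarith⟩, by linarith, by linarith⟩
  have hmemU : ∀ z ∈ U, a₁ < z.re ∧ z.re < 2 ∧ |z.im| < H₁ := by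
    intro z hz
    obtain ⟨⟨h1, h2⟩, h3, h4⟩ := hz
    exact ⟨h1, h2, abs_lt.mpr ⟨h3, h4⟩⟩
  -- the poles lie inside the open rectangle
  have hSsub : (S : Set ℂ) ⊆ Ioo a 1 ×ℂ Ioo (-H) H := by
    intro p hp
    simp only [hS, Finset.coe_insert, Finset.coe_singleton, Set.mem_insert_iff,
      Set.mem_singleton_iff] at hp
    rcases hp with rfl | rfl | rfl | rfl
    · refine ⟨⟨by simp [hpa, hβa]; linarith, by simp [hpa, hβa]⟩, ?_, ?_⟩
      · simp [hpa]; linarith [(abs_lt.mp hβaH).1, (abs_lt.mp hβaH).2]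
      · simp [hpa]; linarith [(abs_lt.mp hβaH).1, (abs_lt.mp hβaH).2]
    · refine ⟨⟨by simp [hpb, hβb]; linarith, by simp [hpb, hβb]⟩, ?_, ?_⟩
      · simp [hpb]; linarith [(abs_lt.mp hβbH).1, (abs_lt.mp hβbH).2]
      · simp [hpb]; linarith [(abs_lt.mp hβbH).1, (abs_lt.mp hβbH).2]
    · refine ⟨⟨by simp [hpk, hβ]; linarith, by simp [hpk, hβ]⟩, ?_, ?_⟩
      · simp [hpk]; linarith [(abs_lt.mp hβH).1, (abs_lt.mp hβH).2]
      · simp [hpk]; linarith [(abs_lt.mp hβH).1, (abs_lt.mp hβH).2]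
    · refine ⟨⟨?_, ?_⟩, ?_, ?_⟩
      · simp [hpr]; linarith
      · simp [hpr]; linarith
      · simp [hpr]; linarith
      · simp [hpr]; linarith
  -- holomorphy off the poles
  have hρ910 : 9 / 10 < ρ := by linarith
  have hG : DifferentiableOn ℂ (fun s => Φ s * ((Y : ℂ) ^ (s + β) * omega1 Λ (s + β) / (s + β)))
      (U \ ↑S) := by
    have h := differentiableOn_G χ Φ M cst βa βb β Λ hχ1 hMd hY hΦ ρ U
      (fun z hz => hUζ z (hmemU z hz).1 (hmemU z hz).2.1 (hmemU z hz).2.2)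
      (fun z hz => by have := (hmemU z hz).1; simp; linarith)
      (fun z hz hne => hUL z (hmemU z hz).1 (hmemU z hz).2.1 (hmemU z hz).2.2 hne)
    simpa [hS, hpa, hpb, hpk, hpr] using h
  -- facts at the poles
  have hUpa : pa ∈ U := hKU ⟨⟨(hSsub (by simp [hS])).1.1.le, (hSsub (by simp [hS])).1.2.le⟩,
    (hSsub (by simp [hS])).2.1.le, (hSsub (by simp [hS])).2.2.le⟩
  have hUpb : pb ∈ U := hKU ⟨⟨(hSsub (by simp [hS])).1.1.le, (hSsub (by simp [hS])).1.2.le⟩,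
    (hSsub (by simp [hS])).2.1.le, (hSsub (by simp [hS])).2.2.le⟩
  have hUpk : pk ∈ U := hKU ⟨⟨(hSsub (by simp [hS])).1.1.le, (hSsub (by simp [hS])).1.2.le⟩,
    (hSsub (by simp [hS])).2.1.le, (hSsub (by simp [hS])).2.2.le⟩
  have hUpr : pr ∈ U := hKU ⟨⟨(hSsub (by simp [hS])).1.1.le, (hSsub (by simp [hS])).1.2.le⟩,
    (hSsub (by simp [hS])).2.1.le, (hSsub (by simp [hS])).2.2.le⟩
  have hζa : riemannZeta₁ (1 - βa) ≠ 0 := by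
    have := hUζ pa (hmemU pa hUpa).1 (hmemU pa hUpa).2.1 (hmemU pa hUpa).2.2
    simpa [hpa, sub_eq_add_neg] using this
  have hζb : riemannZeta₁ (1 - βb) ≠ 0 := by
    have := hUζ pb (hmemU pb hUpb).1 (hmemU pb hUpb).2.1 (hmemU pb hUpb).2.2
    simpa [hpb, sub_eq_add_neg] using this
  have hζk : riemannZeta₁ (1 - β) ≠ 0 := by
    have := hUζ pk (hmemU pk hUpk).1 (hmemU pk hUpk).2.1 (hmemU pk hUpk).2.2
    simpa [hpk, sub_eq_add_neg] using this
  have hζr : riemannZeta₁ ρ ≠ 0 := by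
    have := hUζ pr (hmemU pr hUpr).1 (hmemU pr hUpr).2.1 (hmemU pr hUpr).2.2
    have h1 : (1 : ℂ) + pr = ρ := by simp [hpr]
    rwa [h1] at this
  have hLa : χ.LFunction (1 - βa) ≠ 0 := by
    have := hUL pa (hmemU pa hUpa).1 (hmemU pa hUpa).2.1 (hmemU pa hUpa).2.2 har'
    simpa [hpa, sub_eq_add_neg] using this
  have hLb : χ.LFunction (1 - βb) ≠ 0 := by
    have := hUL pb (hmemU pb hUpb).1 (hmemU pb hUpb).2.1 (hmemU pb hUpb).2.2 hbr'
    simpa [hpb, sub_eq_add_neg] using this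
  have hLk : χ.LFunction (1 - β) ≠ 0 := by
    have := hUL pk (hmemU pk hUpk).1 (hmemU pk hUpk).2.1 (hmemU pk hUpk).2.2 hkr'
    simpa [hpk, sub_eq_add_neg] using this
  -- pole data
  have hΦ' : ∀ s, Φ s = riemannZeta (1 + s + βb) * riemannZeta (1 + s + βa) * M (1 + s) * cst * s /
      (riemannZeta₁ (1 + s) * χ.LFunction (1 + s)) := fun s => by rw [hΦ s]; ring
  have hpole : ∀ p ∈ S, ∃ V ∈ 𝓝 p, DifferentiableOn ℂ (φ p) V ∧
      ∀ z ∈ V, z ≠ p → Φ z * ((Y : ℂ) ^ (z + β) * omega1 Λ (z + β) / (z + β)) = φ p z / (z - p) := by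
    intro p hp
    simp only [hS, Finset.mem_insert, Finset.mem_singleton] at hp
    rcases hp with rfl | rfl | rfl | rfl
    · rw [hφpa]
      exact pole_at_neg_betaA χ Φ M cst βa βb β Λ hχ1 hMd hY hΦ hζa hLa (by rw [hβa]; norm_num)
        hab haβ
    · rw [hφpb]
      exact pole_at_neg_betaA χ Φ M cst βb βa β Λ hχ1 hMd hY hΦ' hζb hLb (by rw [hβb]; norm_num)
        (Ne.symm hab) hbβ
    · rw [hφpk]
      exact pole_at_neg_beta χ Φ M cst βa βb β Λ hχ1 hMd hY hΦ hζk hLk (by rw [hβ]; norm_num)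
        (Ne.symm haβ) (Ne.symm hbβ)
    · rw [hφpr]
      exact pole_at_rho χ Φ M cst βa βb β Λ hχ1 hMd hY hΦ hρL hρL' hζr hρ910
        (Ne.symm har') (Ne.symm hbr') (Ne.symm hkr')
  -- the engine
  have hσ₀ : (1 : ℝ) + β.re ≠ 0 := by rw [hβ]; norm_num
  have haβre : a + β.re ≠ 0 := by rw [hβ]; simpa using ha.ne
  have eng := GaussKernelContour.norm_lineIntegral_sub_residues_le_of_simplePoles
    (Φ := Φ) (β := β) (Λ := Λ) (Y := Y) hΛ hY (a := a) (σ₀ := 1) (H := H) (M₀ := M₀) (M₁ := M₁)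
    (M₂ := M₂) (by linarith) hβH haβre hσ₀ hM₀ hM₁ hM₂ hΦ₀ hΦ₁
    (fun u h1 h2 => hΦ₂ u h1 h2) hint S φ U hUopen hKU hSsub hG hpole
  -- the residue sum
  have hsum : ∑ p ∈ S, φ p p = φa pa + φb pb + φk pk + φr pr := by
    rw [hS, Finset.sum_insert (by simp [hab', hak', har']), Finset.sum_insert (by simp [hbk', hbr']),
      Finset.sum_insert (by simp [hkr']), Finset.sum_singleton, hφpa, hφpb, hφpk, hφpr]
    ring
  rw [hsum] at eng
  simpa only [hφa, hφb, hφk, hφr, hpa, hpb, hpk, hpr] using eng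

/-- **The same contour shift, for an arbitrary open neighbourhood `U` of the closed rectangle**
`[a,1] × [−H,H]` on which `ζ₁(1+z) ≠ 0`, `Re(1+z) > 9/10` and (`z ≠ ρ−1` ⇒ `L(1+z,χ) ≠ 0`) — the form
consumed by `Section15BEq1515Ranged`, where `U` is manufactured from zero-free data on the CLOSED
region `Re(1+z) ≥ 1 − c₁/𝓛` (the left side of Landau's rectangle lies on the boundary of that region).
[cite: Zhang2022LandauSiegel, §15 (15.15)–(15.16) p.85] [cite: MontgomeryVaughan2007, §6.2] -/
theorem core_of_open (hχ1 : χ ≠ 1) (hMd : DifferentiableOn ℂ M {w : ℂ | 9 / 10 < w.re})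
    (hY : 0 < Y) (hΛ : 0 < Λ)
    (hΦ : ∀ s, Φ s = riemannZeta (1 + s + βa) * riemannZeta (1 + s + βb) * M (1 + s) * cst * s /
      (riemannZeta₁ (1 + s) * χ.LFunction (1 + s)))
    (hβa : βa.re = 0) (hβb : βb.re = 0) (hβ : β.re = 0)
    (ha0 : βa ≠ 0) (hb0 : βb ≠ 0) (hβ0 : β ≠ 0) (hab : βa ≠ βb) (haβ : βa ≠ β) (hbβ : βb ≠ β)
    {a H : ℝ} (ha10 : -(1 / 10 : ℝ) < a) (ha : a < 0)
    (hβH : |β.im| < H) (hβaH : |βa.im| < H) (hβbH : |βb.im| < H)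
    {ρ : ℝ} (hρL : χ.LFunction ρ = 0) (hρL' : deriv χ.LFunction ρ ≠ 0) (hρ1 : ρ < 1)
    (haρ : a < ρ - 1)
    (U : Set ℂ) (hUopen : IsOpen U) (hKU : Icc a 1 ×ℂ Icc (-H) H ⊆ U)
    (hUζ : ∀ z ∈ U, riemannZeta₁ (1 + z) ≠ 0) (hUre : ∀ z ∈ U, 9 / 10 < (1 + z).re)
    (hUL : ∀ z ∈ U, z ≠ ((ρ - 1 : ℝ) : ℂ) → χ.LFunction (1 + z) ≠ 0)
    {M₀ M₁ M₂ : ℝ} (hM₀ : 0 ≤ M₀) (hM₁ : 0 ≤ M₁) (hM₂ : 0 ≤ M₂)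
    (hΦ₀ : ∀ t : ℝ, H ≤ |t| → ‖Φ (((1 : ℝ) : ℂ) + t * I)‖ ≤ M₀)
    (hΦ₁ : ∀ t : ℝ, |t| ≤ H → ‖Φ ((a : ℂ) + t * I)‖ ≤ M₁)
    (hΦ₂ : ∀ u : ℝ, a ≤ u → u ≤ 1 →
      ‖Φ ((u : ℂ) + (H : ℂ) * I)‖ ≤ M₂ ∧ ‖Φ ((u : ℂ) + ((-H : ℝ) : ℂ) * I)‖ ≤ M₂)
    (hint : Integrable fun t : ℝ => Φ (((1 : ℝ) : ℂ) + t * I) *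
      ((Y : ℂ) ^ (((1 : ℝ) : ℂ) + t * I + β) * omega1 Λ (((1 : ℝ) : ℂ) + t * I + β) /
        (((1 : ℝ) : ℂ) + t * I + β))) :
    ‖(1 / (2 * π) : ℂ) * (∫ t : ℝ, Φ (((1 : ℝ) : ℂ) + t * I) *
        ((Y : ℂ) ^ (((1 : ℝ) : ℂ) + t * I + β) * omega1 Λ (((1 : ℝ) : ℂ) + t * I + β) /
          (((1 : ℝ) : ℂ) + t * I + β))) -
      ( -- residue at `−β_a`
        riemannZeta₁ (1 + -βa + βa) * riemannZeta (1 + -βa + βb) *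
          (M (1 + -βa) * cst * -βa / (riemannZeta₁ (1 + -βa) * χ.LFunction (1 + -βa))) *
          ((Y : ℂ) ^ (-βa + β) * omega1 Λ (-βa + β)) / (-βa + β) +
        -- residue at `−β_b`
        riemannZeta₁ (1 + -βb + βb) * riemannZeta (1 + -βb + βa) *
          (M (1 + -βb) * cst * -βb / (riemannZeta₁ (1 + -βb) * χ.LFunction (1 + -βb))) *
          ((Y : ℂ) ^ (-βb + β) * omega1 Λ (-βb + β)) / (-βb + β) +
        -- residue at `−β`
        Φ (-β) * ((Y : ℂ) ^ (-β + β) * omega1 Λ (-β + β)) +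
        -- residue at `ρ − 1`
        riemannZeta (1 + ((ρ - 1 : ℝ) : ℂ) + βa) * riemannZeta (1 + ((ρ - 1 : ℝ) : ℂ) + βb) *
          (M (1 + ((ρ - 1 : ℝ) : ℂ)) * cst * ((ρ - 1 : ℝ) : ℂ) /
            (riemannZeta₁ (1 + ((ρ - 1 : ℝ) : ℂ)) *
              dslope (fun w => χ.LFunction w) ρ (1 + ((ρ - 1 : ℝ) : ℂ)))) *
          ((Y : ℂ) ^ (((ρ - 1 : ℝ) : ℂ) + β) * omega1 Λ (((ρ - 1 : ℝ) : ℂ) + β) /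
            (((ρ - 1 : ℝ) : ℂ) + β)))‖ ≤
      1 / (2 * π) *
        (2 * (M₀ * (Y ^ ((1 : ℝ) + β.re) * rexp (((1 : ℝ) + β.re) ^ 2 / (4 * Λ)) / |(1 : ℝ) + β.re|) *
            (gauss (4 * Λ)⁻¹ (H - |β.im|) * (Real.sqrt (4 * π * Λ) / 2))) +
          M₁ * (Y ^ (a + β.re) * rexp ((a + β.re) ^ 2 / (4 * Λ)) / |a + β.re|) *
            Real.sqrt (4 * π * Λ) +
          2 * (((1 : ℝ) - a) * (M₂ * (max (Y ^ (a + β.re)) (Y ^ ((1 : ℝ) + β.re)) *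
            rexp (max ((a + β.re) ^ 2) (((1 : ℝ) + β.re) ^ 2) / (4 * Λ)) *
            gauss (4 * Λ)⁻¹ (H - |β.im|) / (H - |β.im|))))) := by
  classical
  -- the four poles
  set pa : ℂ := -βa with hpa
  set pb : ℂ := -βb with hpb
  set pk : ℂ := -β with hpk
  set pr : ℂ := ((ρ - 1 : ℝ) : ℂ) with hpr
  -- their numerators
  set φa : ℂ → ℂ := fun z => riemannZeta₁ (1 + z + βa) * riemannZeta (1 + z + βb) *
      (M (1 + z) * cst * z / (riemannZeta₁ (1 + z) * χ.LFunction (1 + z))) *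
      ((Y : ℂ) ^ (z + β) * omega1 Λ (z + β)) / (z + β) with hφa
  set φb : ℂ → ℂ := fun z => riemannZeta₁ (1 + z + βb) * riemannZeta (1 + z + βa) *
      (M (1 + z) * cst * z / (riemannZeta₁ (1 + z) * χ.LFunction (1 + z))) *
      ((Y : ℂ) ^ (z + β) * omega1 Λ (z + β)) / (z + β) with hφb
  set φk : ℂ → ℂ := fun z => Φ z * ((Y : ℂ) ^ (z + β) * omega1 Λ (z + β)) with hφk
  set φr : ℂ → ℂ := fun z => riemannZeta (1 + z + βa) * riemannZeta (1 + z + βb) *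
      (M (1 + z) * cst * z / (riemannZeta₁ (1 + z) * dslope (fun w => χ.LFunction w) ρ (1 + z))) *
      ((Y : ℂ) ^ (z + β) * omega1 Λ (z + β) / (z + β)) with hφr
  -- distinctness
  have hβaim : βa.im ≠ 0 := fun h => ha0 (Complex.ext (by simpa using hβa) (by simpa using h))
  have hβbim : βb.im ≠ 0 := fun h => hb0 (Complex.ext (by simpa using hβb) (by simpa using h))
  have hβim : β.im ≠ 0 := fun h => hβ0 (Complex.ext (by simpa using hβ) (by simpa using h))
  have hab' : pa ≠ pb := fun h => hab (neg_injective h)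
  have hak' : pa ≠ pk := fun h => haβ (neg_injective h)
  have hbk' : pb ≠ pk := fun h => hbβ (neg_injective h)
  have har' : pa ≠ pr := by
    intro h; apply hβaim
    have := congrArg Complex.im h
    simpa [hpa, hpr] using this
  have hbr' : pb ≠ pr := by
    intro h; apply hβbim
    have := congrArg Complex.im h
    simpa [hpb, hpr] using this
  have hkr' : pk ≠ pr := by
    intro h; apply hβim
    have := congrArg Complex.im h
    simpa [hpk, hpr] using this
  -- the pole set and the numerator family
  set S : Finset ℂ := {pa, pb, pk, pr} with hS
  set φ : ℂ → ℂ → ℂ := fun p => if p = pa then φa else if p = pb then φb else if p = pk then φk else φr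
    with hφ
  have hφpa : φ pa = φa := by simp [hφ]
  have hφpb : φ pb = φb := by simp [hφ, hab'.symm]
  have hφpk : φ pk = φk := by simp [hφ, hak'.symm, hbk'.symm]
  have hφpr : φ pr = φr := by simp [hφ, har'.symm, hbr'.symm, hkr'.symm]
  have hH : 0 < H := lt_of_le_of_lt (abs_nonneg _) hβH
  -- the poles lie inside the open rectangle
  have hSsub : (S : Set ℂ) ⊆ Ioo a 1 ×ℂ Ioo (-H) H := by
    intro p hp
    simp only [hS, Finset.coe_insert, Finset.coe_singleton, Set.mem_insert_iff,
      Set.mem_singleton_iff] at hp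
    rcases hp with rfl | rfl | rfl | rfl
    · refine ⟨⟨by simp [hpa, hβa]; linarith, by simp [hpa, hβa]⟩, ?_, ?_⟩
      · simp [hpa]; linarith [(abs_lt.mp hβaH).1, (abs_lt.mp hβaH).2]
      · simp [hpa]; linarith [(abs_lt.mp hβaH).1, (abs_lt.mp hβaH).2]
    · refine ⟨⟨by simp [hpb, hβb]; linarith, by simp [hpb, hβb]⟩, ?_, ?_⟩
      · simp [hpb]; linarith [(abs_lt.mp hβbH).1, (abs_lt.mp hβbH).2]
      · simp [hpb]; linarith [(abs_lt.mp hβbH).1, (abs_lt.mp hβbH).2]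
    · refine ⟨⟨by simp [hpk, hβ]; linarith, by simp [hpk, hβ]⟩, ?_, ?_⟩
      · simp [hpk]; linarith [(abs_lt.mp hβH).1, (abs_lt.mp hβH).2]
      · simp [hpk]; linarith [(abs_lt.mp hβH).1, (abs_lt.mp hβH).2]
    · refine ⟨⟨?_, ?_⟩, ?_, ?_⟩
      · simp [hpr]; linarith
      · simp [hpr]; linarith
      · simp [hpr]; linarith
      · simp [hpr]; linarith
  -- holomorphy off the poles
  have hρ910 : 9 / 10 < ρ := by linarith
  have hG : DifferentiableOn ℂ (fun s => Φ s * ((Y : ℂ) ^ (s + β) * omega1 Λ (s + β) / (s + β)))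
      (U \ ↑S) := by
    have h := differentiableOn_G χ Φ M cst βa βb β Λ hχ1 hMd hY hΦ ρ U hUζ hUre hUL
    simpa [hS, hpa, hpb, hpk, hpr] using h
  -- facts at the poles
  have hUpa : pa ∈ U := hKU ⟨⟨(hSsub (by simp [hS])).1.1.le, (hSsub (by simp [hS])).1.2.le⟩,
    (hSsub (by simp [hS])).2.1.le, (hSsub (by simp [hS])).2.2.le⟩
  have hUpb : pb ∈ U := hKU ⟨⟨(hSsub (by simp [hS])).1.1.le, (hSsub (by simp [hS])).1.2.le⟩,
    (hSsub (by simp [hS])).2.1.le, (hSsub (by simp [hS])).2.2.le⟩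
  have hUpk : pk ∈ U := hKU ⟨⟨(hSsub (by simp [hS])).1.1.le, (hSsub (by simp [hS])).1.2.le⟩,
    (hSsub (by simp [hS])).2.1.le, (hSsub (by simp [hS])).2.2.le⟩
  have hUpr : pr ∈ U := hKU ⟨⟨(hSsub (by simp [hS])).1.1.le, (hSsub (by simp [hS])).1.2.le⟩,
    (hSsub (by simp [hS])).2.1.le, (hSsub (by simp [hS])).2.2.le⟩
  have hζa : riemannZeta₁ (1 - βa) ≠ 0 := by
    simpa [hpa, sub_eq_add_neg] using hUζ pa hUpa
  have hζb : riemannZeta₁ (1 - βb) ≠ 0 := by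
    simpa [hpb, sub_eq_add_neg] using hUζ pb hUpb
  have hζk : riemannZeta₁ (1 - β) ≠ 0 := by
    simpa [hpk, sub_eq_add_neg] using hUζ pk hUpk
  have hζr : riemannZeta₁ ρ ≠ 0 := by
    have := hUζ pr hUpr
    have h1 : (1 : ℂ) + pr = ρ := by simp [hpr]
    rwa [h1] at this
  have hLa : χ.LFunction (1 - βa) ≠ 0 := by
    simpa [hpa, sub_eq_add_neg] using hUL pa hUpa har'
  have hLb : χ.LFunction (1 - βb) ≠ 0 := by
    simpa [hpb, sub_eq_add_neg] using hUL pb hUpb hbr'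
  have hLk : χ.LFunction (1 - β) ≠ 0 := by
    simpa [hpk, sub_eq_add_neg] using hUL pk hUpk hkr'
  -- pole data
  have hΦ' : ∀ s, Φ s = riemannZeta (1 + s + βb) * riemannZeta (1 + s + βa) * M (1 + s) * cst * s /
      (riemannZeta₁ (1 + s) * χ.LFunction (1 + s)) := fun s => by rw [hΦ s]; ring
  have hpole : ∀ p ∈ S, ∃ V ∈ 𝓝 p, DifferentiableOn ℂ (φ p) V ∧
      ∀ z ∈ V, z ≠ p → Φ z * ((Y : ℂ) ^ (z + β) * omega1 Λ (z + β) / (z + β)) = φ p z / (z - p) := by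
    intro p hp
    simp only [hS, Finset.mem_insert, Finset.mem_singleton] at hp
    rcases hp with rfl | rfl | rfl | rfl
    · rw [hφpa]
      exact pole_at_neg_betaA χ Φ M cst βa βb β Λ hχ1 hMd hY hΦ hζa hLa (by rw [hβa]; norm_num)
        hab haβ
    · rw [hφpb]
      exact pole_at_neg_betaA χ Φ M cst βb βa β Λ hχ1 hMd hY hΦ' hζb hLb (by rw [hβb]; norm_num)
        (Ne.symm hab) hbβ
    · rw [hφpk]
      exact pole_at_neg_beta χ Φ M cst βa βb β Λ hχ1 hMd hY hΦ hζk hLk (by rw [hβ]; norm_num)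
        (Ne.symm haβ) (Ne.symm hbβ)
    · rw [hφpr]
      exact pole_at_rho χ Φ M cst βa βb β Λ hχ1 hMd hY hΦ hρL hρL' hζr hρ910
        (Ne.symm har') (Ne.symm hbr') (Ne.symm hkr')
  -- the engine
  have hσ₀ : (1 : ℝ) + β.re ≠ 0 := by rw [hβ]; norm_num
  have haβre : a + β.re ≠ 0 := by rw [hβ]; simpa using ha.ne
  have eng := GaussKernelContour.norm_lineIntegral_sub_residues_le_of_simplePoles
    (Φ := Φ) (β := β) (Λ := Λ) (Y := Y) hΛ hY (a := a) (σ₀ := 1) (H := H) (M₀ := M₀) (M₁ := M₁)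
    (M₂ := M₂) (by linarith) hβH haβre hσ₀ hM₀ hM₁ hM₂ hΦ₀ hΦ₁
    (fun u h1 h2 => hΦ₂ u h1 h2) hint S φ U hUopen hKU hSsub hG hpole
  -- the residue sum
  have hsum : ∑ p ∈ S, φ p p = φa pa + φb pb + φk pk + φr pr := by
    rw [hS, Finset.sum_insert (by simp [hab', hak', har']), Finset.sum_insert (by simp [hbk', hbr']),
      Finset.sum_insert (by simp [hkr']), Finset.sum_singleton, hφpa, hφpb, hφpk, hφpr]
    ring
  rw [hsum] at eng
  simpa only [hφa, hφb, hφk, hφr, hpa, hpb, hpk, hpr] using eng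


end Literature.NumberTheory.LFunctions.Zhang2022.Eq1515
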